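import Mathlib.Analysis.InnerProductSpace.Calculus
import Mathlib.Analysis.InnerProductSpace.PiL2
import Mathlib.Analysis.SpecialFunctions.Trigonometric.Deriv
import Mathlib.Analysis.Calculus.ContDiff.RCLike
import Mathlib.Analysis.Calculus.Deriv.MeanValue
import Mathlib.Analysis.Normed.Module.Convex
import Mathlib.Analysis.Normed.Module.RCLike.Basic
import Mathlib.Topology.MetricSpace.Thickening
import Mathlib.Analysis.Calculus.InverseFunctionTheorem.ContDiff
import Mathlib.Analysis.Normed.Ring.Units
import Literature.Topology.FourManifolds.StraightLineIsotopyExtension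
import HarnessLib

/-!
# Blending a cap-fixing diffeomorphism with the identity along the unit sphere

Topic `Literature/Topology/FourManifolds`; analytic core of the cap germ alignment used by the
fact seat of Alexander's theorem
(`provefact-Literature.Topology.FourManifolds.SphereEmbedding.schoenflies_exists_ball`, Schultens
(2014), Thm. 3.2.5: "standard model of a neighbourhood of the ball", Lemma 3.2.3).  **Everything
in this file is proved; no definitions, no named facts.**

Let `ι : E → E` be smooth with everywhere injective differential, equal to the identity on the
part of the unit sphere inside an open set `W₁` and mapping the open unit ball into itself there,
and let `ρ : E → [0, 1]` be a cutoff, smooth and positively homogeneous of degree `0` off the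
origin, whose support meets the sphere inside a compact `K ⊆ W₁`.  The **blend**
`b x = x + ρ x • (ι x - x)` is the identity on the unit sphere, equals `ι` where `ρ = 1`, and:

* §1 cone lemma; `b = id` on the sphere; the inner shell is mapped into the ball (convexity);
* §2 at sphere points `⟪Dι(p) p, p⟫ > 0` (`inner_fderiv_self_pos`) and `Db(p)` is injective
  (`injective_fderiv_blend`);
* §3 the outer shell is mapped outside the ball (`one_lt_norm_blend`), by the sign of the radial
  derivative and compactness of the sphere.

This is the tangential analogue of the radial splice of `CollarUniquenessBall.lean` (Hirsch
(1976), Ch. 8, Thm. 1.8: uniqueness of collars).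

## References
* M. W. Hirsch, *Differential Topology*, GTM 33 (1976), Ch. 8 §1 Thm. 1.8, §3 Thm. 3.1.
* J. Schultens, *Introduction to 3-Manifolds*, GSM 151 (2014), Lemma 3.2.3, Thm. 3.2.5.
-/

open scoped RealInnerProductSpace Topology ContDiff
open Set Filter Metric Function

noncomputable section

namespace Literature.Topology.FourManifolds

namespace CapBlend

variable {E : Type*} [NormedAddCommGroup E] [InnerProductSpace ℝ E]

/-! ### §1 The cone lemma; the blend on the sphere and on the inner shell -/

/-- **Cone lemma.**  If `K` is a compact subset of the unit sphere inside the open set `W₁`, then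
all points `x ≠ 0` with direction `x/‖x‖ ∈ K` and `|‖x‖ - 1| < ε₁` lie in `W₁`, for some
`ε₁ > 0`. [folklore] -/
theorem exists_cone_subset {W₁ K : Set E} (hW₁ : IsOpen W₁) (hKc : IsCompact K) (hKW : K ⊆ W₁) :
    ∃ ε₁, 0 < ε₁ ∧ ∀ x : E, x ≠ 0 → ‖x‖⁻¹ • x ∈ K → |‖x‖ - 1| < ε₁ → x ∈ W₁ := by
  -- the continuous map `(ω, r) ↦ r • ω` sends `K × {1}` into `W₁`
  set m : E × ℝ → E := fun p => p.2 • p.1 with hm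
  have hmc : Continuous m := continuous_snd.smul continuous_fst
  have hopen : IsOpen (m ⁻¹' W₁) := hW₁.preimage hmc
  have hsub : K ×ˢ ({1} : Set ℝ) ⊆ m ⁻¹' W₁ := by
    rintro ⟨w, r⟩ ⟨hw, hr⟩
    rw [mem_singleton_iff] at hr
    subst hr
    show (1 : ℝ) • w ∈ W₁
    rw [one_smul]; exact hKW hw
  obtain ⟨u, v, hu, hv, hKu, h1v, huv⟩ := generalized_tube_lemma hKc isCompact_singleton hopen hsub
  have h1 : (1 : ℝ) ∈ v := h1v (mem_singleton 1)
  obtain ⟨ε₁, hε₁, hball⟩ := Metric.isOpen_iff.1 hv 1 h1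
  refine ⟨ε₁, hε₁, fun x hx hxK hxn => ?_⟩
  have hr : ‖x‖ ∈ v := hball (by rw [mem_ball, Real.dist_eq]; exact hxn)
  have : (‖x‖⁻¹ • x, ‖x‖) ∈ u ×ˢ v := ⟨hKu hxK, hr⟩
  have := huv this
  simp only [mem_preimage, hm] at this
  rwa [smul_smul, mul_inv_cancel₀ (norm_ne_zero_iff.2 hx), one_smul] at this

section Blend

variable {ι : E → E} {ρ : E → ℝ} {W₁ K : Set E}

/-- **The blend is the identity on the unit sphere.** [folklore] -/
theorem blend_eq_self_of_norm_eq_one (hid : ∀ x ∈ W₁, ‖x‖ = 1 → ι x = x) (hKW : K ⊆ W₁)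
    (hρK : ∀ x : E, x ≠ 0 → ρ x ≠ 0 → ‖x‖⁻¹ • x ∈ K) {x : E} (hx : ‖x‖ = 1) :
    x + ρ x • (ι x - x) = x := by
  by_cases hρ : ρ x = 0
  · rw [hρ, zero_smul, add_zero]
  · have hx0 : x ≠ 0 := by rintro rfl; simp at hx
    have hK : x ∈ K := by simpa [hx] using hρK x hx0 hρ
    rw [hid x (hKW hK) hx, sub_self, smul_zero, add_zero]

/-- **Off the support cone the blend is the identity**, on a neighbourhood: if the direction of
`x ≠ 0` is not in `K` then `b = id` near `x`. [folklore] -/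
theorem blend_eventuallyEq_id (hKc : IsClosed K)
    (hρK : ∀ x : E, x ≠ 0 → ρ x ≠ 0 → ‖x‖⁻¹ • x ∈ K) {x : E} (hx : x ≠ 0) (hxK : ‖x‖⁻¹ • x ∉ K) :
    (fun y => y + ρ y • (ι y - y)) =ᶠ[𝓝 x] id := by
  have hc : ContinuousAt (fun y : E => ‖y‖⁻¹ • y) x :=
    (continuous_norm.continuousAt.inv₀ (norm_ne_zero_iff.2 hx)).smul continuousAt_id
  have h1 : ∀ᶠ y in 𝓝 x, ‖y‖⁻¹ • y ∉ K :=
    hc.preimage_mem_nhds (hKc.isOpen_compl.mem_nhds hxK)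
  have h2 : ∀ᶠ y in 𝓝 x, y ≠ (0 : E) := isOpen_compl_singleton.mem_nhds hx
  filter_upwards [h1, h2] with y hy hy0
  have : ρ y = 0 := by
    by_contra h; exact hy (hρK y hy0 h)
  simp [this]

/-- **The inner shell is mapped into the open ball** (the blend at `x` is a convex combination of
`x` and `ι x`, both in the ball). [folklore] -/
theorem norm_blend_lt_one (hρ01 : ∀ x, ρ x ∈ Icc (0 : ℝ) 1)
    (hin : ∀ x ∈ W₁, ‖x‖ < 1 → ‖ι x‖ < 1)
    (hρK : ∀ x : E, x ≠ 0 → ρ x ≠ 0 → ‖x‖⁻¹ • x ∈ K) {ε₁ : ℝ} (hε₁ : ε₁ ≤ 1)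
    (hcone : ∀ x : E, x ≠ 0 → ‖x‖⁻¹ • x ∈ K → |‖x‖ - 1| < ε₁ → x ∈ W₁)
    {x : E} (h1 : 1 - ε₁ < ‖x‖) (h2 : ‖x‖ < 1) : ‖x + ρ x • (ι x - x)‖ < 1 := by
  by_cases hρ : ρ x = 0
  · rw [hρ, zero_smul, add_zero]; exact h2
  · have hx0 : x ≠ 0 := by
      rintro rfl
      rw [norm_zero] at h1
      linarith
    have hxW : x ∈ W₁ := hcone x hx0 (hρK x hx0 hρ) (by rw [abs_lt]; constructor <;> linarith)
    have hιx : ‖ι x‖ < 1 := hin x hxW h2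
    have heq : x + ρ x • (ι x - x) = (1 - ρ x) • x + ρ x • ι x := by
      rw [smul_sub, sub_smul, one_smul]; abel
    rw [heq, ← mem_ball_zero_iff]
    exact (convex_ball (0 : E) 1) (mem_ball_zero_iff.2 h2) (mem_ball_zero_iff.2 hιx)
      (by linarith [(hρ01 x).2]) (hρ01 x).1 (by ring)

/-- **The closed inner shell is mapped into the closed ball.** [folklore] -/
theorem norm_blend_le_one (hρ01 : ∀ x, ρ x ∈ Icc (0 : ℝ) 1)
    (hid : ∀ x ∈ W₁, ‖x‖ = 1 → ι x = x) (hKW : K ⊆ W₁)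
    (hin : ∀ x ∈ W₁, ‖x‖ < 1 → ‖ι x‖ < 1)
    (hρK : ∀ x : E, x ≠ 0 → ρ x ≠ 0 → ‖x‖⁻¹ • x ∈ K) {ε₁ : ℝ} (hε₁ : ε₁ ≤ 1)
    (hcone : ∀ x : E, x ≠ 0 → ‖x‖⁻¹ • x ∈ K → |‖x‖ - 1| < ε₁ → x ∈ W₁)
    {x : E} (h1 : 1 - ε₁ < ‖x‖) (h2 : ‖x‖ ≤ 1) : ‖x + ρ x • (ι x - x)‖ ≤ 1 := by
  rcases h2.lt_or_eq with h | h
  · exact (norm_blend_lt_one hρ01 hin hρK hε₁ hcone h1 h).le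
  · rw [blend_eq_self_of_norm_eq_one hid hKW hρK h, h]

/-! ### §2 Derivatives at sphere points -/

/-- **Tangential derivative.**  If `ι = id` on the unit sphere near `p` (`‖p‖ = 1`), then
`Dι(p) v = v` for every `v ⊥ p` (differentiate along the great circle through `p` in the
direction `v`). [folklore] -/
theorem fderiv_apply_of_inner_eq_zero (hW₁ : IsOpen W₁) (hid : ∀ x ∈ W₁, ‖x‖ = 1 → ι x = x)
    (hι : Differentiable ℝ ι) {p : E} (hp : ‖p‖ = 1) (hpW : p ∈ W₁) {v : E} (hv : ⟪p, v⟫ = 0) :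
    fderiv ℝ ι p v = v := by
  by_cases hv0 : v = 0
  · rw [hv0, map_zero]
  -- the great circle `γ t = cos (t‖v‖) p + sin (t‖v‖) ‖v‖⁻¹ v`, `γ 0 = p`, `γ' 0 = v`
  set c : ℝ := ‖v‖ with hc
  have hc0 : 0 < c := norm_pos_iff.2 hv0
  set γ : ℝ → E := fun t => Real.cos (c * t) • p + (Real.sin (c * t) * c⁻¹) • v with hγ
  have hγ0 : γ 0 = p := by simp [hγ]
  have hγd : HasDerivAt γ v 0 := by
    have h0 : HasDerivAt (fun t : ℝ => c * t) c 0 := by simpa using (hasDerivAt_id (0:ℝ)).const_mul c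
    have h1 : HasDerivAt (fun t => Real.cos (c * t)) (-Real.sin (c * 0) * c) 0 := h0.cos
    have h2 : HasDerivAt (fun t => Real.sin (c * t) * c⁻¹) (Real.cos (c * 0) * c * c⁻¹) 0 :=
      h0.sin.mul_const c⁻¹
    have := (h1.smul_const p).add (h2.smul_const v)
    simp only [mul_zero, Real.sin_zero, neg_zero, zero_mul, zero_smul, Real.cos_zero, one_mul,
      mul_inv_cancel₀ hc0.ne', one_smul, zero_add] at this
    exact this
  -- `γ t` is on the unit sphere
  have hγn : ∀ t, ‖γ t‖ = 1 := by
    intro t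
    have hpp : ⟪p, p⟫ = 1 := by rw [real_inner_self_eq_norm_sq, hp, one_pow]
    have hvv : ⟪v, v⟫ = c ^ 2 := by rw [real_inner_self_eq_norm_sq]
    have h : ‖γ t‖ ^ 2 = 1 := by
      rw [← real_inner_self_eq_norm_sq]
      simp only [hγ, inner_add_left, inner_add_right, inner_smul_left, inner_smul_right, hpp, hvv, hv,
        real_inner_comm p v, RCLike.conj_to_real]
      field_simp
      nlinarith [Real.cos_sq_add_sin_sq (c * t)]
    nlinarith [norm_nonneg (γ t)]
  -- near `t = 0`, `γ t ∈ W₁`, so `ι (γ t) = γ t`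
  have hγc : Continuous γ := by
    simp only [hγ]
    fun_prop
  have hev : ∀ᶠ t in 𝓝 (0:ℝ), ι (γ t) = γ t := by
    have : γ ⁻¹' W₁ ∈ 𝓝 (0:ℝ) := hγc.continuousAt.preimage_mem_nhds (by rw [hγ0]; exact hW₁.mem_nhds hpW)
    filter_upwards [this] with t ht using hid _ ht (hγn t)
  -- differentiate `ι ∘ γ = γ` at `0`
  have hcomp : HasDerivAt (ι ∘ γ) (fderiv ℝ ι p v) 0 := by
    have h := (hι (γ 0)).hasFDerivAt.comp_hasDerivAt 0 hγd
    rw [hγ0] at h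
    exact h
  have hcomp' : HasDerivAt (ι ∘ γ) v 0 := hγd.congr_of_eventuallyEq (by
    filter_upwards [hev] with t ht; exact ht)
  exact hcomp.unique hcomp'

/-- **Transversality at the sphere.**  If `ι` has injective differential at `p` (`‖p‖ = 1`,
`p ∈ W₁`), is the identity on the sphere near `p` and maps the open ball into itself near `p`,
then `⟪Dι(p) p, p⟫ > 0`. [folklore] -/
theorem inner_fderiv_self_pos (hW₁ : IsOpen W₁) (hid : ∀ x ∈ W₁, ‖x‖ = 1 → ι x = x)
    (hin : ∀ x ∈ W₁, ‖x‖ < 1 → ‖ι x‖ < 1) (hι : Differentiable ℝ ι)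
    {p : E} (hp : ‖p‖ = 1) (hpW : p ∈ W₁) (hinj : Injective (fderiv ℝ ι p)) :
    0 < ⟪fderiv ℝ ι p p, p⟫ := by
  have hp0 : p ≠ 0 := by rintro rfl; simp at hp
  have hιp : ι p = p := hid p hpW hp
  -- nonnegativity: `t ↦ ‖ι (p - t p)‖²` is `< 1 = value at 0` for small `t > 0`
  have hnonneg : 0 ≤ ⟪fderiv ℝ ι p p, p⟫ := by
    set g : ℝ → ℝ := fun t => ‖ι (p - t • p)‖ ^ 2 with hg
    have hgd : HasDerivAt g (2 * ⟪ι p, fderiv ℝ ι p (-p)⟫) 0 := by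
      have hl : HasDerivAt (fun t : ℝ => p - t • p) (-p) 0 := by
        have := ((hasDerivAt_id (0:ℝ)).smul_const p).const_sub p
        simpa using this
      have h1 : HasDerivAt (fun t : ℝ => ι (p - t • p)) (fderiv ℝ ι p (-p)) 0 := by
        have h := (hι (p - (0:ℝ) • p)).hasFDerivAt.comp_hasDerivAt (0:ℝ) hl
        simp only [zero_smul, sub_zero] at h
        exact h
      have h2 := HasDerivAt.norm_sq h1
      simp only [zero_smul, sub_zero] at h2
      exact h2
    -- `g t < g 0` for small `t > 0`
    have hlt : ∀ᶠ t in 𝓝[>] (0:ℝ), g t < g 0 := by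
      have hmem : ∀ᶠ t in 𝓝 (0:ℝ), p - t • p ∈ W₁ := by
        have hc : Continuous fun t : ℝ => p - t • p := by fun_prop
        exact hc.continuousAt.preimage_mem_nhds (by simpa using hW₁.mem_nhds hpW)
      have hpos : ∀ᶠ t in 𝓝[>] (0:ℝ), 0 < t ∧ t < 1 := by
        filter_upwards [Ioo_mem_nhdsGT one_pos] with t ht using ht
      filter_upwards [hpos, nhdsWithin_le_nhds hmem] with t ht htW
      have hn : ‖p - t • p‖ < 1 := by
        rw [show p - t • p = (1 - t) • p by rw [sub_smul, one_smul], norm_smul,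
          Real.norm_of_nonneg (by linarith [ht.2]), hp, mul_one]
        linarith [ht.1]
      have := hin _ htW hn
      simp only [hg, zero_smul, sub_zero, hιp, hp, one_pow]
      nlinarith [norm_nonneg (ι (p - t • p))]
    -- hence the right derivative is `≤ 0`
    have hslope := hgd.tendsto_slope_zero_right
    have hle : 2 * ⟪ι p, fderiv ℝ ι p (-p)⟫ ≤ 0 := by
      refine le_of_tendsto hslope ?_
      filter_upwards [hlt, self_mem_nhdsWithin] with t ht ht0
      have ht0' : (0:ℝ) < t := ht0
      rw [zero_add] at *
      exact smul_nonpos_of_nonneg_of_nonpos (inv_nonneg.2 ht0'.le) (by linarith)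
    rw [map_neg, inner_neg_right, hιp, real_inner_comm] at hle
    linarith
  -- positivity: if `⟪Dι p, p⟫ = 0` then `Dι (p - u) = 0` for `u = Dι p ∈ pᗮ`, contradiction
  rcases hnonneg.lt_or_eq with h | h
  · exact h
  · exfalso
    set u := fderiv ℝ ι p p with hu
    have huperp : ⟪p, u⟫ = 0 := by rw [real_inner_comm]; exact h.symm
    have hDu : fderiv ℝ ι p u = u := fderiv_apply_of_inner_eq_zero hW₁ hid hι hp hpW huperp
    have hzero : fderiv ℝ ι p (p - u) = 0 := by rw [map_sub, hDu, hu, sub_self]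
    have hpu : p - u ≠ 0 := by
      intro hpu
      have : ⟪p, p - u⟫ = 0 := by rw [hpu, inner_zero_right]
      rw [inner_sub_right, huperp, sub_zero, real_inner_self_eq_norm_sq, hp] at this
      norm_num at this
    exact hpu (hinj (by rw [hzero, map_zero]))

/-- **The derivative of the blend at a sphere point is injective.**  At `p` (`‖p‖ = 1`) the
blend `b x = x + ρ x • (ι x - x)` has derivative `(1 - ρ p) I + ρ p Dι(p)` (the term
`(ι p - p) ⊗ Dρ(p)` vanishes), and this is injective: on `pᗮ` it is the identity and
`⟪((1 - ρ) I + ρ Dι) p, p⟫ = (1 - ρ) + ρ ⟪Dι p, p⟫ > 0`. [folklore] -/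
theorem injective_fderiv_blend (hW₁ : IsOpen W₁) (hid : ∀ x ∈ W₁, ‖x‖ = 1 → ι x = x)
    (hin : ∀ x ∈ W₁, ‖x‖ < 1 → ‖ι x‖ < 1) (hι : ContDiff ℝ ∞ ι)
    (hDι : ∀ x, Injective (fderiv ℝ ι x))
    (hρs : ContDiffOn ℝ ∞ ρ {0}ᶜ) (hρ01 : ∀ x, ρ x ∈ Icc (0 : ℝ) 1)
    (hKc : IsClosed K) (hKW : K ⊆ W₁)
    (hρK : ∀ x : E, x ≠ 0 → ρ x ≠ 0 → ‖x‖⁻¹ • x ∈ K) {p : E} (hp : ‖p‖ = 1) :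
    Injective (fderiv ℝ (fun x => x + ρ x • (ι x - x)) p) := by
  have hp0 : p ≠ 0 := by rintro rfl; simp at hp
  have hιd : Differentiable ℝ ι := hι.differentiable (by simp)
  by_cases hpK : p ∈ K
  · -- the derivative is `(1 - ρ p) I + ρ p Dι(p)`
    have hpW : p ∈ W₁ := hKW hpK
    have hιp : ι p = p := hid p hpW hp
    have hρd : DifferentiableAt ℝ ρ p :=
      (hρs.differentiableOn (by simp) p (by simpa using hp0)).differentiableAt
        (isOpen_compl_singleton.mem_nhds hp0)
    have hD : HasFDerivAt (fun x => x + ρ x • (ι x - x))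
        (ContinuousLinearMap.id ℝ E + (ρ p • (fderiv ℝ ι p - ContinuousLinearMap.id ℝ E) +
          (fderiv ℝ ρ p).smulRight (ι p - p))) p := by
      have h1 : HasFDerivAt (fun x => ι x - x) (fderiv ℝ ι p - ContinuousLinearMap.id ℝ E) p :=
        (hιd p).hasFDerivAt.sub (hasFDerivAt_id p)
      exact (hasFDerivAt_id p).add (hρd.hasFDerivAt.smul h1)
    rw [hD.fderiv]
    intro w w' hww'
    -- it suffices to treat the kernel
    rw [← sub_eq_zero] at hww' ⊢
    rw [← map_sub] at hww'
    set d := w - w' with hd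
    have hL : d + ρ p • (fderiv ℝ ι p d - d) = 0 := by
      have := hww'
      simp only [add_apply, ContinuousLinearMap.smulRight_apply, hιp, sub_self, smul_zero,
        add_zero, FunLike.coe_smul, Pi.smul_apply, sub_apply, ContinuousLinearMap.coe_id', id_eq] at this
      exact this
    -- decompose `d = α p + v`, `v ⊥ p`
    set α : ℝ := ⟪p, d⟫ with hα
    set v : E := d - α • p with hv
    have hpp : ⟪p, p⟫ = 1 := by rw [real_inner_self_eq_norm_sq, hp, one_pow]
    have hvp : ⟪p, v⟫ = 0 := by rw [hv, inner_sub_right, inner_smul_right, hpp, mul_one, hα, sub_self]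
    have hDv : fderiv ℝ ι p v = v := fderiv_apply_of_inner_eq_zero hW₁ hid hιd hp hpW hvp
    have hdv : d = α • p + v := by rw [hv]; abel
    have hc : 0 < ⟪p, fderiv ℝ ι p p⟫ := by
      rw [real_inner_comm]; exact inner_fderiv_self_pos hW₁ hid hin hιd hp hpW (hDι p)
    -- take the inner product of `hL` with `p`
    have key : α * (1 - ρ p + ρ p * ⟪p, fderiv ℝ ι p p⟫) = 0 := by
      have h0 := congrArg (fun z => ⟪p, z⟫) hL
      simp only [inner_zero_right] at h0
      rw [hdv] at h0
      simp only [map_add, map_smul, hDv, inner_add_right, inner_smul_right, inner_sub_right, hpp, hvp,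
        smul_sub, add_sub_add_right_eq_sub] at h0
      linarith
    have hbr : 0 < 1 - ρ p + ρ p * ⟪p, fderiv ℝ ι p p⟫ := by
      obtain ⟨h0, h1⟩ := hρ01 p
      nlinarith [mul_nonneg h0 hc.le]
    have hα0 : α = 0 := by
      rcases mul_eq_zero.1 key with h | h
      · exact h
      · linarith
    have hdv' : d = v := by rw [hdv, hα0, zero_smul, zero_add]
    rw [hdv', hDv, sub_self, smul_zero, add_zero] at hL
    rw [hdv', hL]
  · -- off the support cone, `b = id` near `p`
    have hev := blend_eventuallyEq_id (ι := ι) hKc hρK hp0 (by simpa [hp] using hpK)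
    rw [hev.fderiv_eq, fderiv_id]
    exact fun a b h => by simpa using h

/-! ### §3 The outer shell is mapped outside the ball -/

/-- The blend is smooth off the origin. [folklore] -/
theorem contDiffOn_blend (hι : ContDiff ℝ ∞ ι) (hρs : ContDiffOn ℝ ∞ ρ {0}ᶜ) :
    ContDiffOn ℝ ∞ (fun x => x + ρ x • (ι x - x)) {0}ᶜ :=
  contDiffOn_id.add (hρs.smul (hι.contDiffOn.sub contDiffOn_id))

/-- **The radial derivative of `‖b‖²` at a sphere point is positive**:
`⟪Db(p) p, p⟫ = (1 - ρ p) + ρ p ⟪Dι(p) p, p⟫ > 0`. [folklore] -/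
theorem inner_fderiv_blend_self_pos (hW₁ : IsOpen W₁) (hid : ∀ x ∈ W₁, ‖x‖ = 1 → ι x = x)
    (hin : ∀ x ∈ W₁, ‖x‖ < 1 → ‖ι x‖ < 1) (hι : ContDiff ℝ ∞ ι)
    (hDι : ∀ x, Injective (fderiv ℝ ι x))
    (hρs : ContDiffOn ℝ ∞ ρ {0}ᶜ) (hρ01 : ∀ x, ρ x ∈ Icc (0 : ℝ) 1)
    (hKc : IsClosed K) (hKW : K ⊆ W₁)
    (hρK : ∀ x : E, x ≠ 0 → ρ x ≠ 0 → ‖x‖⁻¹ • x ∈ K) {p : E} (hp : ‖p‖ = 1) :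
    0 < ⟪fderiv ℝ (fun x => x + ρ x • (ι x - x)) p p, p⟫ := by
  have hp0 : p ≠ 0 := by rintro rfl; simp at hp
  have hpp : ⟪p, p⟫ = 1 := by rw [real_inner_self_eq_norm_sq, hp, one_pow]
  have hιd : Differentiable ℝ ι := hι.differentiable (by simp)
  by_cases hpK : p ∈ K
  · have hpW : p ∈ W₁ := hKW hpK
    have hιp : ι p = p := hid p hpW hp
    have hρd : DifferentiableAt ℝ ρ p :=
      (hρs.differentiableOn (by simp) p (by simpa using hp0)).differentiableAt
        (isOpen_compl_singleton.mem_nhds hp0)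
    have hD : HasFDerivAt (fun x => x + ρ x • (ι x - x))
        (ContinuousLinearMap.id ℝ E + (ρ p • (fderiv ℝ ι p - ContinuousLinearMap.id ℝ E) +
          (fderiv ℝ ρ p).smulRight (ι p - p))) p := by
      have h1 : HasFDerivAt (fun x => ι x - x) (fderiv ℝ ι p - ContinuousLinearMap.id ℝ E) p :=
        (hιd p).hasFDerivAt.sub (hasFDerivAt_id p)
      exact (hasFDerivAt_id p).add (hρd.hasFDerivAt.smul h1)
    rw [hD.fderiv]
    simp only [add_apply, ContinuousLinearMap.smulRight_apply, hιp, sub_self, smul_zero, add_zero,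
      FunLike.coe_smul, Pi.smul_apply, sub_apply, ContinuousLinearMap.coe_id', id_eq,
      inner_add_left, inner_smul_left, inner_sub_left, hpp, RCLike.conj_to_real]
    have hc := inner_fderiv_self_pos hW₁ hid hin hιd hp hpW (hDι p)
    obtain ⟨h0, h1⟩ := hρ01 p
    nlinarith [mul_nonneg h0 hc.le]
  · have hev := blend_eventuallyEq_id (ι := ι) hKc hρK hp0 (by simpa [hp] using hpK)
    rw [hev.fderiv_eq, fderiv_id, ContinuousLinearMap.coe_id', id_eq, hpp]
    exact one_pos

variable [FiniteDimensional ℝ E]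

/-- **The outer shell is mapped outside the closed ball**: for some `ε₃ > 0`, every `x` with
`1 < ‖x‖ < 1 + ε₃` has `‖b x‖ > 1`.  Along each ray `t ↦ p + t p` the function `‖b‖²` has
positive derivative at `t = 0` (`inner_fderiv_blend_self_pos`), hence — by continuity of the
derivative and compactness of the sphere — on `[0, ε₃] × 𝕊`, so it increases from its value `1`
at `t = 0`. [folklore] -/
theorem one_lt_norm_blend (hW₁ : IsOpen W₁) (hid : ∀ x ∈ W₁, ‖x‖ = 1 → ι x = x)
    (hin : ∀ x ∈ W₁, ‖x‖ < 1 → ‖ι x‖ < 1) (hι : ContDiff ℝ ∞ ι)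
    (hDι : ∀ x, Injective (fderiv ℝ ι x))
    (hρs : ContDiffOn ℝ ∞ ρ {0}ᶜ) (hρ01 : ∀ x, ρ x ∈ Icc (0 : ℝ) 1)
    (hKc : IsClosed K) (hKW : K ⊆ W₁)
    (hρK : ∀ x : E, x ≠ 0 → ρ x ≠ 0 → ‖x‖⁻¹ • x ∈ K) :
    ∃ ε₃, 0 < ε₃ ∧ ∀ x : E, 1 < ‖x‖ → ‖x‖ < 1 + ε₃ → 1 < ‖x + ρ x • (ι x - x)‖ := by
  set b : E → E := fun x => x + ρ x • (ι x - x) with hb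
  have hbs : ContDiffOn ℝ ∞ b {0}ᶜ := contDiffOn_blend hι hρs
  have hbd : DifferentiableOn ℝ b {0}ᶜ := hbs.differentiableOn (by simp)
  have hDbc : ContinuousOn (fun x => fderiv ℝ b x) {0}ᶜ :=
    (hbs.continuousOn_fderiv_of_isOpen isOpen_compl_singleton (by simp))
  -- the derivative along rays: `D (t, p) = 2 ⟪Db(p + t p) p, b (p + t p)⟫`
  set D : ℝ × E → ℝ := fun q => 2 * ⟪fderiv ℝ b (q.2 + q.1 • q.2) q.2, b (q.2 + q.1 • q.2)⟫ with hD
  -- on `S = (-1/2, 1/2) × {x ≠ 0}` the point `p + t p` is nonzero, and `D` is continuous there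
  set S : Set (ℝ × E) := Ioo (-(1/2 : ℝ)) (1/2) ×ˢ {x | x ≠ 0} with hS
  have hSo : IsOpen S := isOpen_Ioo.prod isOpen_compl_singleton
  have hne : ∀ q ∈ S, q.2 + q.1 • q.2 ≠ (0 : E) := by
    rintro ⟨t, p⟩ ⟨ht, hp⟩
    have : p + t • p = (1 + t) • p := by rw [add_smul, one_smul]
    rw [this, smul_ne_zero_iff]
    exact ⟨by linarith [ht.1], hp⟩
  have hline : Continuous fun q : ℝ × E => q.2 + q.1 • q.2 := continuous_snd.add (continuous_fst.smul continuous_snd)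
  have hDc : ContinuousOn D S := by
    have h1 : ContinuousOn (fun q : ℝ × E => fderiv ℝ b (q.2 + q.1 • q.2)) S :=
      hDbc.comp hline.continuousOn fun q hq => hne q hq
    have h2 : ContinuousOn (fun q : ℝ × E => fderiv ℝ b (q.2 + q.1 • q.2) q.2) S :=
      h1.clm_apply continuous_snd.continuousOn
    have h3 : ContinuousOn (fun q : ℝ × E => b (q.2 + q.1 • q.2)) S :=
      hbs.continuousOn.comp hline.continuousOn fun q hq => hne q hq
    exact continuousOn_const.mul (h2.inner h3)
  -- positivity on `{0} × 𝕊`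
  have hpos0 : ∀ p : E, ‖p‖ = 1 → 0 < D (0, p) := by
    intro p hp
    have hb0 : b p = p := blend_eq_self_of_norm_eq_one hid hKW hρK hp
    simp only [hD, zero_smul, add_zero, hb0]
    exact mul_pos two_pos (inner_fderiv_blend_self_pos hW₁ hid hin hι hDι hρs hρ01 hKc hKW hρK hp)
  -- the open positivity set contains `{0} × 𝕊`; tube lemma
  have hUo : IsOpen (S ∩ D ⁻¹' Ioi 0) := hDc.isOpen_inter_preimage hSo isOpen_Ioi
  have hsub : ({(0:ℝ)} : Set ℝ) ×ˢ sphere (0 : E) 1 ⊆ S ∩ D ⁻¹' Ioi 0 := by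
    rintro ⟨t, p⟩ ⟨ht, hp⟩
    rw [mem_singleton_iff] at ht
    subst ht
    have hp1 : ‖p‖ = 1 := mem_sphere_zero_iff_norm.1 hp
    refine ⟨⟨by norm_num, ?_⟩, hpos0 p hp1⟩
    show p ≠ 0
    rintro rfl; simp at hp1
  obtain ⟨u, v, hu, -, h0u, hSv, huv⟩ :=
    generalized_tube_lemma isCompact_singleton (isCompact_sphere (0 : E) 1) hUo hsub
  obtain ⟨ε₃, hε₃, hball⟩ := Metric.isOpen_iff.1 hu 0 (h0u (mem_singleton 0))
  refine ⟨min ε₃ (1/4), lt_min hε₃ (by norm_num), fun x hx1 hx2 => ?_⟩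
  -- write `x = p + t p`
  have hx0 : x ≠ 0 := by
    rintro rfl
    rw [norm_zero] at hx1
    linarith
  set p : E := ‖x‖⁻¹ • x with hpdef
  set t : ℝ := ‖x‖ - 1 with htdef
  have hp1 : ‖p‖ = 1 := norm_smul_inv_norm (𝕜 := ℝ) hx0
  have hpS : p ∈ sphere (0 : E) 1 := mem_sphere_zero_iff_norm.2 hp1
  have hxeq : ∀ s : ℝ, p + s • p = (1 + s) • p := fun s => by rw [add_smul, one_smul]
  have hxpt : x = p + t • p := by
    rw [hxeq, htdef, hpdef, smul_smul, add_sub_cancel, mul_inv_cancel₀ (norm_ne_zero_iff.2 hx0), one_smul]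
  have ht0 : 0 < t := by rw [htdef]; linarith
  have htε : t < min ε₃ (1/4) := by rw [htdef]; linarith
  -- along the ray the derivative is positive on `[0, t]`
  have hray : ∀ s ∈ Icc 0 t, 0 < D (s, p) := by
    intro s hs
    have hsu : s ∈ u := hball (by
      rw [mem_ball, Real.dist_eq, sub_zero, abs_of_nonneg hs.1]
      exact lt_of_le_of_lt hs.2 (htε.trans_le (min_le_left _ _)))
    exact (huv ⟨hsu, hSv hpS⟩).2
  -- `g s = ‖b (p + s p)‖²` is strictly increasing on `[0, t]`
  set g : ℝ → ℝ := fun s => ‖b (p + s • p)‖ ^ 2 with hg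
  have hp0 : p ≠ 0 := by
    intro h
    rw [h, norm_zero] at hp1
    exact zero_ne_one hp1
  have hgd : ∀ s, -(1/2 : ℝ) < s → HasDerivAt g (D (s, p)) s := by
    intro s hs
    have hne' : p + s • p ≠ 0 := by
      rw [hxeq, smul_ne_zero_iff]; exact ⟨by linarith, hp0⟩
    have hl : HasDerivAt (fun s : ℝ => p + s • p) p s := by
      simpa using ((hasDerivAt_id s).smul_const p).const_add p
    have hbx : HasFDerivAt b (fderiv ℝ b (p + s • p)) (p + s • p) :=
      ((hbd _ (mem_compl_singleton_iff.2 hne')).differentiableAt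
        (isOpen_compl_singleton.mem_nhds hne')).hasFDerivAt
    have h1 : HasDerivAt (b ∘ fun s : ℝ => p + s • p) (fderiv ℝ b (p + s • p) p) s :=
      hbx.comp_hasDerivAt s hl
    have h2 := HasDerivAt.norm_sq h1
    have h3 : D (s, p) = 2 * ⟪b (p + s • p), fderiv ℝ b (p + s • p) p⟫ := by
      simp only [hD]; rw [real_inner_comm]
    rw [h3]
    exact h2
  have hmono : StrictMonoOn g (Icc 0 t) := by
    refine strictMonoOn_of_deriv_pos (convex_Icc 0 t) (fun s hs => (hgd s (by linarith [hs.1])).continuousAt.continuousWithinAt)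
      fun s hs => ?_
    rw [interior_Icc] at hs
    rw [(hgd s (by linarith [hs.1])).deriv]
    exact hray s ⟨hs.1.le, hs.2.le⟩
  have hg0 : g 0 = 1 := by
    show ‖b (p + (0:ℝ) • p)‖ ^ 2 = 1
    rw [zero_smul, add_zero, show b p = p from blend_eq_self_of_norm_eq_one hid hKW hρK hp1, hp1, one_pow]
  have hgt : 1 < g t := by
    rw [← hg0]
    exact hmono ⟨le_rfl, ht0.le⟩ ⟨ht0.le, le_rfl⟩ ht0
  rw [hxpt]
  have : 1 < ‖b (p + t • p)‖ ^ 2 := hgt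
  nlinarith [norm_nonneg (b (p + t • p))]

/-! ### §4 The blend is a diffeomorphism near the sphere -/

omit [FiniteDimensional ℝ E] in
/-- On a finite-dimensional space an injective continuous linear endomorphism is an
equivalence. [folklore] -/
theorem exists_continuousLinearEquiv_of_injective [FiniteDimensional ℝ E] {L : E →L[ℝ] E}
    (h : Injective L) : ∃ e : E ≃L[ℝ] E, (e : E →L[ℝ] E) = L := by
  refine ⟨(LinearEquiv.ofInjectiveEndo L.toLinearMap h).toContinuousLinearEquiv, ?_⟩
  ext x
  rfl

/-- The points off the origin where the blend has injective differential form an open set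
(units of the complete normed ring `E →L E` are open). [folklore] -/
theorem isOpen_setOf_injective_fderiv {f : E → E} (hf : ContDiffOn ℝ ∞ f {0}ᶜ) :
    IsOpen {x : E | x ≠ 0 ∧ Injective (fderiv ℝ f x)} := by
  have hc : ContinuousOn (fun x => fderiv ℝ f x) {0}ᶜ :=
    hf.continuousOn_fderiv_of_isOpen isOpen_compl_singleton (by simp)
  have heq : {x : E | x ≠ 0 ∧ Injective (fderiv ℝ f x)} =
      {0}ᶜ ∩ (fun x => fderiv ℝ f x) ⁻¹' {L : E →L[ℝ] E | IsUnit L} := by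
    ext x
    simp only [mem_setOf_eq, mem_inter_iff, mem_compl_iff, mem_singleton_iff, mem_preimage]
    constructor
    · rintro ⟨hx, hinj⟩
      obtain ⟨e, he⟩ := exists_continuousLinearEquiv_of_injective hinj
      refine ⟨hx, ⟨(ContinuousLinearEquiv.unitsEquiv ℝ E).symm e, ?_⟩⟩
      rw [← he]
      rfl
    · rintro ⟨hx, u, hu⟩
      refine ⟨hx, ?_⟩
      rw [← hu]
      exact (ContinuousLinearEquiv.unitsEquiv ℝ E u).injective
  rw [heq]
  exact hc.isOpen_inter_preimage isOpen_compl_singleton Units.isOpen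

/-- **The blend is a diffeomorphism of a neighbourhood of the sphere onto a neighbourhood of
the sphere.**  There are an open `V ⊆ {x ≠ 0}` containing a shell `{|‖x‖ - 1| < ε}` on which
`b` is injective with injective differential, with open image `b(V)` containing a shell, and
a map `g`, smooth on `b(V)`, inverse to `b` there. [folklore] -/
theorem exists_shell_inverse (hW₁ : IsOpen W₁) (hid : ∀ x ∈ W₁, ‖x‖ = 1 → ι x = x)
    (hin : ∀ x ∈ W₁, ‖x‖ < 1 → ‖ι x‖ < 1) (hι : ContDiff ℝ ∞ ι)
    (hDι : ∀ x, Injective (fderiv ℝ ι x))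
    (hρs : ContDiffOn ℝ ∞ ρ {0}ᶜ) (hρ01 : ∀ x, ρ x ∈ Icc (0 : ℝ) 1)
    (hKc : IsClosed K) (hKW : K ⊆ W₁)
    (hρK : ∀ x : E, x ≠ 0 → ρ x ≠ 0 → ‖x‖⁻¹ • x ∈ K) :
    ∃ (V : Set E) (g : E → E) (ε : ℝ), IsOpen V ∧ 0 < ε ∧ V ⊆ {0}ᶜ ∧
      (∀ x : E, |‖x‖ - 1| < ε → x ∈ V) ∧
      InjOn (fun x => x + ρ x • (ι x - x)) V ∧
      (∀ x ∈ V, Injective (fderiv ℝ (fun x => x + ρ x • (ι x - x)) x)) ∧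
      (∀ S : Set E, IsOpen S → S ⊆ V → IsOpen ((fun x => x + ρ x • (ι x - x)) '' S)) ∧
      (∀ y : E, |‖y‖ - 1| < ε → y ∈ (fun x => x + ρ x • (ι x - x)) '' V) ∧
      ContDiffOn ℝ ∞ g ((fun x => x + ρ x • (ι x - x)) '' V) ∧
      (∀ x ∈ V, g (x + ρ x • (ι x - x)) = x) ∧
      (∀ y ∈ (fun x => x + ρ x • (ι x - x)) '' V, (g y + ρ (g y) • (ι (g y) - g y)) = y ∧ g y ∈ V) := by
  set b : E → E := fun x => x + ρ x • (ι x - x) with hb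
  have hbs : ContDiffOn ℝ ∞ b {0}ᶜ := contDiffOn_blend hι hρs
  have hbat : ∀ x : E, x ≠ 0 → ContDiffAt ℝ ∞ b x := fun x hx =>
    hbs.contDiffAt (isOpen_compl_singleton.mem_nhds hx)
  have hsph : ∀ p : E, ‖p‖ = 1 → b p = p := fun p hp => blend_eq_self_of_norm_eq_one hid hKW hρK hp
  -- the open set of good points
  set U : Set E := {x : E | x ≠ 0 ∧ Injective (fderiv ℝ b x)} with hU
  have hUo : IsOpen U := isOpen_setOf_injective_fderiv hbs
  -- charts at good points
  have hchart : ∀ x ∈ U, ∃ e : E ≃L[ℝ] E, HasFDerivAt b (e : E →L[ℝ] E) x := by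
    rintro x ⟨hx0, hinj⟩
    obtain ⟨e, he⟩ := exists_continuousLinearEquiv_of_injective hinj
    exact ⟨e, by rw [he]; exact ((hbat x hx0).differentiableAt (by simp)).hasFDerivAt⟩
  -- local injectivity at sphere points, then injectivity near the sphere
  have hsphU : ∀ p : E, ‖p‖ = 1 → p ∈ U := fun p hp =>
    ⟨by rintro rfl; simp at hp, injective_fderiv_blend hW₁ hid hin hι hDι hρs hρ01 hKc hKW hρK hp⟩
  obtain ⟨V₀, hV₀o, hSV₀, hinjV₀⟩ : ∃ V₀ : Set E, IsOpen V₀ ∧ sphere (0 : E) 1 ⊆ V₀ ∧ InjOn b V₀ := by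
    refine exists_isOpen_injOn_of_isCompact (isCompact_sphere (0 : E) 1) (fun p hp => ?_)
      (fun p hp q hq hpq => ?_) (fun p hp => ?_)
    · exact (hbat p (by rintro rfl; simp at hp)).continuousAt
    · rwa [hsph p (mem_sphere_zero_iff_norm.1 hp), hsph q (mem_sphere_zero_iff_norm.1 hq)] at hpq
    · have hp1 := mem_sphere_zero_iff_norm.1 hp
      have hp0 : p ≠ 0 := by rintro rfl; simp at hp1
      obtain ⟨e, he⟩ := hchart p (hsphU p hp1)
      set φ := (hbat p hp0).toOpenPartialHomeomorph b he (by simp) with hφ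
      refine ⟨φ.source, φ.open_source.mem_nhds ((hbat p hp0).mem_toOpenPartialHomeomorph_source he (by simp)), ?_⟩
      exact φ.injOn
  -- the open set `V`
  set V : Set E := V₀ ∩ U with hV
  have hVo : IsOpen V := hV₀o.inter hUo
  have hSV : sphere (0 : E) 1 ⊆ V := fun p hp => ⟨hSV₀ hp, hsphU p (mem_sphere_zero_iff_norm.1 hp)⟩
  have hV0 : V ⊆ {0}ᶜ := fun x hx => hx.2.1
  have hinjV : InjOn b V := hinjV₀.mono inter_subset_left
  -- a shell inside `V`
  obtain ⟨ε₁, hε₁, hcone⟩ := exists_cone_subset hVo (isCompact_sphere (0 : E) 1) hSV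
  have hshellV : ∀ x : E, |‖x‖ - 1| < min ε₁ 1 → x ∈ V := by
    intro x hx
    have hx0 : x ≠ 0 := by
      rintro rfl
      rw [norm_zero] at hx
      have := lt_of_lt_of_le hx (min_le_right _ _)
      norm_num at this
    exact hcone x hx0 (mem_sphere_zero_iff_norm.2 (norm_smul_inv_norm (𝕜 := ℝ) hx0)) (lt_of_lt_of_le hx (min_le_left _ _))
  -- `b` is an open map on `V`
  have hopen : ∀ S : Set E, IsOpen S → S ⊆ V → IsOpen (b '' S) := by
    intro S hSo hSV'
    rw [isOpen_iff_mem_nhds]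
    rintro y ⟨x, hxS, rfl⟩
    have hxV := hSV' hxS
    obtain ⟨e, he⟩ := hchart x hxV.2
    set φ := (hbat x hxV.2.1).toOpenPartialHomeomorph b he (by simp) with hφ
    have hxs : x ∈ φ.source := (hbat x hxV.2.1).mem_toOpenPartialHomeomorph_source he (by simp)
    have hop : IsOpen (φ '' (φ.source ∩ S)) :=
      φ.isOpen_image_of_subset_source (φ.open_source.inter hSo) inter_subset_left
    refine mem_of_superset (hop.mem_nhds ⟨x, ⟨hxs, hxS⟩, rfl⟩) ?_
    rintro _ ⟨z, ⟨-, hzS⟩, rfl⟩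
    exact ⟨z, hzS, rfl⟩
  have himo : IsOpen (b '' V) := hopen V hVo Subset.rfl
  -- a shell inside the image
  have hSim : sphere (0 : E) 1 ⊆ b '' V := fun p hp =>
    ⟨p, hSV hp, hsph p (mem_sphere_zero_iff_norm.1 hp)⟩
  obtain ⟨ε₂, hε₂, hcone₂⟩ := exists_cone_subset himo (isCompact_sphere (0 : E) 1) hSim
  have hshellIm : ∀ y : E, |‖y‖ - 1| < min ε₂ 1 → y ∈ b '' V := by
    intro y hy
    have hy0 : y ≠ 0 := by
      rintro rfl
      rw [norm_zero] at hy
      have := lt_of_lt_of_le hy (min_le_right _ _)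
      norm_num at this
    exact hcone₂ y hy0 (mem_sphere_zero_iff_norm.2 (norm_smul_inv_norm (𝕜 := ℝ) hy0)) (lt_of_lt_of_le hy (min_le_left _ _))
  -- the inverse
  haveI : Nonempty E := ⟨0⟩
  set g : E → E := invFunOn b V with hg
  have hleft : ∀ x ∈ V, g (b x) = x := fun x hx => hinjV.leftInvOn_invFunOn hx
  have hright : ∀ y ∈ b '' V, b (g y) = y ∧ g y ∈ V := fun y hy =>
    ⟨invFunOn_eq hy, invFunOn_mem hy⟩
  -- smoothness of the inverse: near `y = b x` it is the local inverse of the chart at `x`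
  have hgs : ContDiffOn ℝ ∞ g (b '' V) := by
    intro y hy
    obtain ⟨hby, hgyV⟩ := hright y hy
    set x := g y with hx
    obtain ⟨e, he⟩ := hchart x hgyV.2
    set φ := (hbat x hgyV.2.1).toOpenPartialHomeomorph b he (by simp) with hφ
    have hxs : x ∈ φ.source := (hbat x hgyV.2.1).mem_toOpenPartialHomeomorph_source he (by simp)
    have hyt : y ∈ φ.target := by rw [← hby]; exact φ.map_source hxs
    have hsx : φ.symm y = x := by rw [← hby]; exact φ.left_inv hxs
    have hsymm : ContDiffAt ℝ ∞ φ.symm y :=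
      φ.contDiffAt_symm hyt (by rw [hsx]; exact he) (by rw [hsx]; exact hbat x hgyV.2.1)
    -- `g = φ.symm` near `y`
    have hev : g =ᶠ[𝓝 y] φ.symm := by
      have h1 : ∀ᶠ y' in 𝓝 y, y' ∈ φ.target := φ.open_target.mem_nhds hyt
      have h2 : ∀ᶠ y' in 𝓝 y, φ.symm y' ∈ V := by
        have hc : ContinuousAt φ.symm y := φ.continuousAt_symm hyt
        exact hc.preimage_mem_nhds (by rw [hsx]; exact hVo.mem_nhds hgyV)
      filter_upwards [h1, h2] with y' hy' hy'V
      have hb' : b (φ.symm y') = y' := φ.right_inv hy'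
      have : g (b (φ.symm y')) = φ.symm y' := hleft _ hy'V
      rwa [hb'] at this
    exact (hsymm.congr_of_eventuallyEq hev).contDiffWithinAt
  refine ⟨V, g, min (min ε₁ 1) (min ε₂ 1), hVo, lt_min (lt_min hε₁ one_pos) (lt_min hε₂ one_pos), hV0,
    fun x hx => hshellV x (lt_of_lt_of_le hx (min_le_left _ _)), hinjV, fun x hx => hx.2.2, hopen,
    fun y hy => hshellIm y (lt_of_lt_of_le hy (min_le_right _ _)), hgs, hleft, hright⟩

end Blend

end CapBlend

end Literature.Topology.FourManifolds

end
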